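import Summits.Ventures.CertifiedQuantumChemistry.Rows.FrozenCoreRelaxationParticleHole
import HarnessLib

/-!
# Ventures/CertifiedQuantumChemistry — Rows/FrozenCoreRelaxationFeasible.lean: DQG feasibility transports
# along the frozen-core extension of an abstract pair

HONEST FRAMING (verbatim): certified bounds for a stated model Hamiltonian in a stated basis; not a
claim about the real molecule beyond that model.

Seat rdm-B (gen 22), file 5 of the relaxation-level frozen-core set (files 1–4:
`Rows/FrozenCoreRelaxation{Pair,Blocks,Hole,ParticleHole}.lean` — the extension `(γ', Γ')`, its blocks, and
the transport of the three cones `D`, `Q`, `G`). Here the LINEAR ROWS of Mazziotti's programme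
(`IsDQGFeasible`, `VariationalRDMRelaxation.lean`) are transported: antisymmetry of `Γ'` in each index
pair (`frozenTwo_swap_fst`, `frozenTwo_swap_snd`; structural, from the three pieces), the trace row
`Tr γ' = N + |K|` (`trace_frozenOne`) and the contraction row `Σ_r Γ'_{(p,r),(q,r)} = (N + |K| − 1) γ'_pq`
(`contract_frozenTwo`: four index patterns; the environment block uses the contraction of the two-matrix
of `|K⟩`, `twoRDM_contract`). Assembled: **`isDQGFeasible_frozen`** — if `(γ, Γ)` is DQG-feasible for
`N` electrons on the active spin orbitals with at least two of them empty (`N + 2 ≤ |ι|`, needed only for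
`1 − γᵀ ⪰ 0`), then `(frozenOne e K γ, frozenTwo e K γ Γ)` is DQG-feasible for `N + |K|` electrons on the
big space. All PROVED (0 sorry, no definition); abstract programme objects only. References: D. A.
Mazziotti, Adv. Chem. Phys. 134 (2007) ch. 3 §II.B eqs. (11)–(17) [Mazziotti2007RDMChapter]; T.
Helgaker, P. Jørgensen, J. Olsen (2000) §12.5.1, (1.7.33) [HelgakerJorgensenOlsen2000].
-/

noncomputable section

namespace Summit.Ventures.CertifiedQuantumChemistry

open Matrix Finset
open Literature.MathematicalPhysics.QuantumLattice Literature.MathematicalPhysics.QuantumChemistry JWEmbed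
open scoped ComplexOrder

variable {ι ι' : Type*} [LinearOrder ι] [LinearOrder ι'] [Fintype ι] [Fintype ι']
variable (e : ι ↪o ι') {K : Finset ι'}

/-! ## Antisymmetry, trace and contraction rows of the extended pair; DQG feasibility transports -/

section Feasible

variable (γ : Matrix ι ι ℂ) (Γ : Matrix (ι × ι) (ι × ι) ℂ)

omit [Fintype ι'] in
/-- `E₂ Γ E₂ᴴ` inherits antisymmetry in the row pair. -/
theorem embTwo_mul_mul_swap_fst (hΓ : ∀ i j q, Γ (j, i) q = -Γ (i, j) q) (p₁ p₂ : ι') (q : ι' × ι') :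
    (embTwo e * Γ * (embTwo e)ᴴ) (p₂, p₁) q = -(embTwo e * Γ * (embTwo e)ᴴ) (p₁, p₂) q := by
  simp only [Matrix.mul_apply, embTwo_apply, embTwo_conjTranspose_apply]
  rw [← Finset.sum_neg_distrib]
  refine Finset.sum_congr rfl fun y _ => ?_
  rw [← neg_mul]
  congr 1
  simp only [Fintype.sum_prod_type]
  rw [Finset.sum_comm, ← Finset.sum_neg_distrib]
  refine Finset.sum_congr rfl fun u _ => ?_
  rw [← Finset.sum_neg_distrib]
  refine Finset.sum_congr rfl fun v _ => ?_
  rw [hΓ u v y]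
  simp only [mul_neg, and_comm]

omit [Fintype ι'] in
/-- `E₂ Γ E₂ᴴ` inherits antisymmetry in the column pair. -/
theorem embTwo_mul_mul_swap_snd (hΓ : ∀ p k l, Γ p (l, k) = -Γ p (k, l)) (p : ι' × ι') (q₁ q₂ : ι') :
    (embTwo e * Γ * (embTwo e)ᴴ) p (q₂, q₁) = -(embTwo e * Γ * (embTwo e)ᴴ) p (q₁, q₂) := by
  simp only [Matrix.mul_apply, embTwo_apply, embTwo_conjTranspose_apply]
  simp only [Fintype.sum_prod_type]
  rw [Finset.sum_comm, ← Finset.sum_neg_distrib]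
  refine Finset.sum_congr rfl fun u _ => ?_
  rw [← Finset.sum_neg_distrib]
  refine Finset.sum_congr rfl fun v _ => ?_
  have h' : ∀ a b : ι, Γ (a, b) (v, u) = -Γ (a, b) (u, v) := fun a b => hΓ (a, b) u v
  simp only [h', mul_neg, Finset.sum_neg_distrib, neg_mul, and_comm]

omit [Fintype ι'] in
/-- `F_k γ F_kᴴ` is antisymmetric in the row pair (the two halves of `mixedPair` carry opposite signs). -/
theorem mixedPair_mul_mul_swap_fst (k : ι') (p₁ p₂ : ι') (q : ι' × ι') :
    (mixedPair e k * γ * (mixedPair e k)ᴴ) (p₂, p₁) q = -(mixedPair e k * γ * (mixedPair e k)ᴴ) (p₁, p₂) q := by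
  rw [mixedPair_mul_mul_apply, mixedPair_mul_mul_apply, ← Finset.sum_neg_distrib]
  refine Finset.sum_congr rfl fun i _ => ?_
  rw [← Finset.sum_neg_distrib]
  refine Finset.sum_congr rfl fun j _ => ?_
  simp only [and_comm]
  ring

omit [Fintype ι'] in
/-- `F_k γ F_kᴴ` is antisymmetric in the column pair. -/
theorem mixedPair_mul_mul_swap_snd (k : ι') (p : ι' × ι') (q₁ q₂ : ι') :
    (mixedPair e k * γ * (mixedPair e k)ᴴ) p (q₂, q₁) = -(mixedPair e k * γ * (mixedPair e k)ᴴ) p (q₁, q₂) := by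
  rw [mixedPair_mul_mul_apply, mixedPair_mul_mul_apply, ← Finset.sum_neg_distrib]
  refine Finset.sum_congr rfl fun i _ => ?_
  rw [← Finset.sum_neg_distrib]
  refine Finset.sum_congr rfl fun j _ => ?_
  simp only [and_comm]
  ring

/-- **Antisymmetry of `Γ'` in the row pair** (from that of `Γ`). -/
theorem frozenTwo_swap_fst (hΓ : ∀ i j q, Γ (j, i) q = -Γ (i, j) q) (p₁ p₂ : ι') (q : ι' × ι') :
    frozenTwo e K γ Γ (p₂, p₁) q = -frozenTwo e K γ Γ (p₁, p₂) q := by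
  rw [frozenTwo, Matrix.add_apply, Matrix.add_apply, Matrix.add_apply, Matrix.add_apply, Matrix.sum_apply,
    Matrix.sum_apply, embTwo_mul_mul_swap_fst e Γ hΓ, twoRDM_swap_fst,
    Finset.sum_congr rfl fun k _ => mixedPair_mul_mul_swap_fst e γ k p₁ p₂ q, Finset.sum_neg_distrib]
  ring

/-- **Antisymmetry of `Γ'` in the column pair** (from that of `Γ`). -/
theorem frozenTwo_swap_snd (hΓ : ∀ p k l, Γ p (l, k) = -Γ p (k, l)) (p : ι' × ι') (q₁ q₂ : ι') :
    frozenTwo e K γ Γ p (q₂, q₁) = -frozenTwo e K γ Γ p (q₁, q₂) := by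
  rw [frozenTwo, Matrix.add_apply, Matrix.add_apply, Matrix.add_apply, Matrix.add_apply, Matrix.sum_apply,
    Matrix.sum_apply, embTwo_mul_mul_swap_snd e Γ hΓ, twoRDM_swap_snd,
    Finset.sum_congr rfl fun k _ => mixedPair_mul_mul_swap_snd e γ k p q₁ q₂, Finset.sum_neg_distrib]
  ring

omit [Fintype ι'] in
/-- The occupation vector `|K⟩` has `|K|` particles. -/
theorem isNParticle_single (K : Finset ι') : IsNParticle K.card (Pi.single K (1 : ℂ) : Fock ι') :=
  fun t ht => by
    rw [Pi.single_apply, if_neg]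
    rintro rfl
    exact ht rfl

/-- **Trace row of the extension**: `Tr γ' = Tr γ + |K|`. -/
theorem trace_frozenOne (hK : Disjoint K (rangeF e)) {N : ℕ} (htr : ∑ i, γ i i = N) :
    ∑ p, frozenOne e K γ p p = ((N + K.card : ℕ) : ℂ) := by
  rw [sum_eq_sum_apply_add_sum_env e]
  simp only [frozenOne_apply_apply e γ hK, htr]
  rw [Finset.sum_congr rfl fun (m : {m : ι' // m ∉ rangeF e}) _ => frozenOne_env_env e γ (K := K) m.2]
  simp only [true_and, sum_env_ite_mem e hK (fun _ => (1 : ℂ)), Finset.sum_const, nsmul_eq_mul, mul_one,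
    Nat.cast_add]

/-- **Contraction row of the extension**: `Σ_r Γ'_{(p,r),(q,r)} = (N + |K| − 1) γ'_{pq}` (four index
patterns: the active block picks up `|K| γ` from the Coulomb blocks; the environment block is the
contraction of the two-matrix of `|K⟩` plus `N` from the Coulomb blocks; the mixed blocks vanish). -/
theorem contract_frozenTwo (hK : Disjoint K (rangeF e)) {N : ℕ} (h : IsDQGFeasible N γ Γ) (p q : ι') :
    ∑ r, frozenTwo e K γ Γ (p, r) (q, r) = (((N + K.card : ℕ) : ℂ) - 1) * frozenOne e K γ p q := by
  rcases rangeF_cases e p with ⟨i, rfl⟩ | hp <;> rcases rangeF_cases e q with ⟨k, rfl⟩ | hq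
  · rw [sum_eq_sum_apply_add_sum_env e, frozenOne_apply_apply e γ hK]
    simp only [frozenTwo_active e γ Γ hK, h.contract i k]
    rw [Finset.sum_congr rfl fun (m : {m : ι' // m ∉ rangeF e}) _ => frozenTwo_IEIE e γ Γ hK i k (K := K) m.2]
    simp only [true_and, sum_env_ite_mem e hK (fun _ => γ i k), Finset.sum_const, nsmul_eq_mul, Nat.cast_add]
    ring
  · rw [sum_eq_sum_apply_add_sum_env e, frozenOne_apply_env e γ hq, mul_zero]
    simp only [frozenTwo_IIEI e γ Γ hK _ _ _ hq, Finset.sum_const_zero, zero_add]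
    exact Finset.sum_eq_zero fun m _ => frozenTwo_IEEE e γ Γ i hq m.2 m.2
  · rw [sum_eq_sum_apply_add_sum_env e, frozenOne_env_apply e γ hp, mul_zero]
    simp only [frozenTwo_EIII e γ Γ hK _ _ _ hp, Finset.sum_const_zero, zero_add]
    exact Finset.sum_eq_zero fun m _ => frozenTwo_EEIE e γ Γ hK k hp m.2
  · -- both environment: `Γ'_{(p,r),(q,r)} = B + C` entrywise (the `E₂ Γ E₂ᴴ` piece vanishes on an env row)
    have hsplit : ∀ r : ι', frozenTwo e K γ Γ (p, r) (q, r) =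
        (∑ k ∈ K, mixedPair e k * γ * (mixedPair e k)ᴴ) (p, r) (q, r) +
          twoRDM (Pi.single K (1 : ℂ)) (p, r) (q, r) := fun r => by
      rw [frozenTwo, Matrix.add_apply, Matrix.add_apply, embTwo_mul_mul_env_fst e Γ hp, zero_add]
    simp only [hsplit, Finset.sum_add_distrib, twoRDM_contract (isNParticle_single K) p q]
    rw [sum_eq_sum_apply_add_sum_env e]
    simp only [sum_mixedPair_mul_mul_EIEI e γ hK, Finset.sum_ite_irrel, h.trace_one, Finset.sum_const_zero]
    rw [Finset.sum_eq_zero fun (m : {m : ι' // m ∉ rangeF e}) _ =>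
      sum_mixedPair_mul_mul_env_row e γ K hp m.2 (q, (m : ι')), add_zero, frozenOne_env_env e γ hp,
      oneRDM_single, Nat.cast_add]
    split_ifs <;> ring

/-- **DQG FEASIBILITY TRANSPORTS ALONG THE FROZEN-CORE EXTENSION**: if `(γ, Γ)` is DQG-feasible for `N`
electrons on the active spin orbitals with at least two of them empty (`N + 2 ≤ |ι|`), then
`(frozenOne e K γ, frozenTwo e K γ Γ)` is DQG-feasible for `N + |K|` electrons on the big space. -/
theorem isDQGFeasible_frozen (hK : Disjoint K (rangeF e)) {N : ℕ} (h : IsDQGFeasible N γ Γ)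
    (hr : N + 2 ≤ Fintype.card ι) :
    IsDQGFeasible (N + K.card) (frozenOne e K γ) (frozenTwo e K γ Γ) where
  herm_one := isHermitian_frozenOne e h.herm_one
  d_psd := posSemidef_frozenTwo_of_isDQGFeasible e h
  q_psd := posSemidef_qMap_frozen_of_isDQGFeasible e γ Γ hK h hr
  g_psd := posSemidef_gMap_frozen_of_isDQGFeasible e γ Γ hK h hr
  trace_one := trace_frozenOne e γ hK h.trace_one
  contract := contract_frozenTwo e γ Γ hK h
  swap_fst p₁ p₂ q := frozenTwo_swap_fst e γ Γ h.swap_fst p₁ p₂ q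
  swap_snd p q₁ q₂ := frozenTwo_swap_snd e γ Γ h.swap_snd p q₁ q₂

end Feasible

end Summit.Ventures.CertifiedQuantumChemistry

end
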